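import Literature.Geometry.Riemannian.PinchingEstimatesReduction
import Literature.Geometry.Riemannian.PinchingEstimatesTwoLargest
import Literature.Geometry.Riemannian.PinchingEstimatesLargest
import HarnessLib

/-!
# Chen–Zhu's Lemma 2.1: the reduction with Hamilton's Thms. 1.2, 1.4, 1.6, 1.7 discharged
(topic `Geometry/Riemannian`)

Corollary file of the decomposition of `Literature.Geometry.Riemannian.hamilton_chenZhu_pinching`
(`PinchingEstimates.lean`): `hamilton_chenZhu_pinching_of_ode₈`
(`PinchingEstimatesReduction.lean`) with the ODE parts of Hamilton 1997, Thm. 1.4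
(`HamiltonODE.hamilton1997_B14_ode`, `PinchingEstimatesTwoLargest.lean`) and Thm. 1.7
(`HamiltonODE.hamilton1997_B17_ode`, `PinchingEstimatesLargest.lean`) supplied by their proofs.
The remaining six hypotheses of `hamilton_chenZhu_pinching_of_ode₆`: the maximum principle for
the curvature ODE (the named fact `hamilton_maximumPrinciple_curvatureODE`), the ODE parts of
Thms. 1.3, 1.9, 2.1 (with Lemma 2.2), 2.3, and the two compactness statements on the initial
metric.

## References

* R. S. Hamilton, *Four-manifolds with positive isotropic curvature*, Comm. Anal. Geom. 5 (1997)
  1–92, §2, Thms. 1.2–2.3 and the proof of Thm. 1.1 (pp. 7–21). [Hamilton1997]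
* B.-L. Chen, X.-P. Zhu, J. Differential Geom. 74 (2006), §2, Lemma 2.1. [ChenZhu2006]
-/

noncomputable section

open Set Real
open scoped Manifold ContDiff Topology Matrix

namespace Literature.Geometry.Riemannian

open Lorentzian Lorentzian.PseudoRiemannianMetric HamiltonODE

universe u

/-- **Chen–Zhu 2006, Lemma 2.1 from the maximum principle for the curvature ODE, the ODE parts
of Hamilton 1997, Thms. 1.3, 1.9, 2.1, 2.3, and the compactness of the initial data** —
`hamilton_chenZhu_pinching_of_ode₈` with Thms. 1.4 and 1.7 supplied by `hamilton1997_B14_ode`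
and `hamilton1997_B17_ode`.
[cite: ChenZhu2006, §2, Lemma 2.1] [cite: Hamilton1997, §2, Thm. 1.1 (proof, pp. 7–21)] -/
theorem hamilton_chenZhu_pinching_of_ode₆ (hMP : hamilton_maximumPrinciple_curvatureODE.{u})
    (h13 : ∀ m Λ : ℝ, 0 < m → 0 < Λ →
      IsInvariantRel field
        (fun _ ↦ {p | (p.1.IsSymm ∧ p.2.2.IsSymm) ∧ p.1.TwoSmallestEigenvaluesSumGE m ∧
          p.2.2.TwoSmallestEigenvaluesSumGE m})
        (fun _ ↦ {p | SingularValuesSumSqLE p Λ}))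
    (h19 : ∀ m ρ Ω P H : ℝ, 0 < m → 0 < ρ → 0 < Ω → 4 * Ω * ρ ≤ P → 0 < H →
      IsInvariantRel field
        (fun _ ↦ {p | (p.1.IsSymm ∧ p.2.2.IsSymm) ∧ p.1.TwoSmallestEigenvaluesSumGE m ∧
          p.2.2.TwoSmallestEigenvaluesSumGE m ∧ Matrix.PinchedBy p.1 p.2.1 p.2.2 ρ Ω})
        (fun t ↦ {p | SingularValueLEExp p H P ρ t}))
    (h21 : ∀ m Λ Ξ : ℝ, 0 < m → 0 < Λ → 0 < Ξ → ∃ K₀ : ℝ, ∀ K : ℝ, K₀ ≤ K → 0 ≤ K →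
      IsInvariantRel field
        (fun _ ↦ {p | (p.1.IsSymm ∧ p.2.2.IsSymm) ∧ p.1.TwoSmallestEigenvaluesSumGE m ∧
          p.2.2.TwoSmallestEigenvaluesSumGE m ∧ SingularValuesSumSqLE p Λ ∧
          MaxLEPairSum p Ξ ∧ p.1.trace = p.2.2.trace})
        (fun _ ↦ {p | ImprovedPinching p K}))
    (h23 : ∀ m Λ Ξ ρ Ω K : ℝ, 0 < m → 0 < Λ → 0 < Ξ → 0 < ρ → 0 < Ω →
      ∃ Q : ℝ, 2 ≤ Q ∧ ∃ L₀ P₀ : ℝ, ∀ L P : ℝ, L₀ ≤ L → P₀ ≤ P → 0 < L → 0 < P →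
        IsInvariantRel field
          (fun t ↦ {p | (p.1.IsSymm ∧ p.2.2.IsSymm) ∧ p.1.TwoSmallestEigenvaluesSumGE m ∧
            p.2.2.TwoSmallestEigenvaluesSumGE m ∧ SingularValuesSumSqLE p Λ ∧
            MaxLEPairSum p Ξ ∧ p.1.trace = p.2.2.trace ∧
            Matrix.PinchedBy p.1 p.2.1 p.2.2 ρ Ω ∧ ImprovedPinching p K ∧
            SingularValueLEExp p (L / 2) P ρ t})
          (fun t ↦ {p | ImprovedPinchingQ p ρ L P Q t}))
    (hbd : ∀ (M : Type u) [TopologicalSpace M] [T2Space M] [SecondCountableTopology M]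
      [CompactSpace M] [ChartedSpace (EuclideanSpace ℝ (Fin 4)) M] [IsManifold (𝓡 4) ∞ M]
      (g : PseudoRiemannianMetric (𝓡 4) ∞ (EuclideanSpace ℝ (Fin 4))
        (TangentSpace (𝓡 4) : M → Type _)),
      g.IsRiemannian →
        ∃ K₀ : ℝ, 0 ≤ K₀ ∧
          ∀ (cov : CovariantDerivative (𝓡 4) (EuclideanSpace ℝ (Fin 4))
            (TangentSpace (𝓡 4) : M → Type _)), g.IsLeviCivita cov →
            ∀ (x : M) (e : Fin 4 → TangentSpace (𝓡 4) x), g.IsOrthonormalFrame x e →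
              ∀ u v : Fin 3 → ℝ, u ⬝ᵥ u = 1 → v ⬝ᵥ v = 1 →
                |u ⬝ᵥ (g.blockA cov x e *ᵥ v)| ≤ K₀ ∧ |u ⬝ᵥ (g.blockB cov x e *ᵥ v)| ≤ K₀ ∧
                  |u ⬝ᵥ (g.blockC cov x e *ᵥ v)| ≤ K₀)
    (hpic : ∀ (M : Type u) [TopologicalSpace M] [T2Space M] [SecondCountableTopology M]
      [CompactSpace M] [ChartedSpace (EuclideanSpace ℝ (Fin 4)) M] [IsManifold (𝓡 4) ∞ M]
      (g : PseudoRiemannianMetric (𝓡 4) ∞ (EuclideanSpace ℝ (Fin 4))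
        (TangentSpace (𝓡 4) : M → Type _)),
      g.IsRiemannian → g.HasPositiveIsotropicCurvature →
        ∃ m : ℝ, 0 < m ∧
          ∀ (cov : CovariantDerivative (𝓡 4) (EuclideanSpace ℝ (Fin 4))
            (TangentSpace (𝓡 4) : M → Type _)), g.IsLeviCivita cov →
            ∀ (x : M) (e : Fin 4 → TangentSpace (𝓡 4) x), g.IsOrthonormalFrame x e →
              (g.blockA cov x e).TwoSmallestEigenvaluesSumGE m ∧
                (g.blockC cov x e).TwoSmallestEigenvaluesSumGE m) :
    hamilton_chenZhu_pinching.{u} :=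
  hamilton_chenZhu_pinching_of_ode₈ hMP h13 hamilton1997_B14_ode hamilton1997_B17_ode h19 h21 h23
    hbd hpic

end Literature.Geometry.Riemannian

end
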